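import Mathlib

/-!
# The `3T+2H` vertex star is impossible

Worker lemma `stub_kill3T2H` of the crux `GappedShellCensus.ShellTrichotomy` (line `Sketch`,
census half).

The census half of the crux abstracts the fan triangulation of a radially projected `12`-point
shell into finite data: a bond graph `bond` on `Fin 12`, a family `tri` of fan triangles
(`3`-sets of labels) and fan angles `ang S v ≥ 0`, vanishing when `v ∉ S` and summing to `2π`
around every label `v`.  Two corner bounds are available: a corner of a *bond triangle* (all
pairs bonded) is `≤ arccos (1/4)` (`tCorner`), and a *half-quad corner* at `v` of a triangle
`{v, a, x}` with `v a`, `a x` bonded but `v x` not bonded is `≤ arccos (807/2000)` (`hCorner`).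

`stub_kill3T2H` kills the `3T+2H` star: a label `v` whose star consists of the three bond
triangles `{v,a,b}`, `{v,b,c}`, `{v,c,d}` together with the two halves `{v,d,x}`, `{v,a,x}` of
the quad `v d x a` cut by its non-bond diagonal `v x` cannot exist, because
`2π = Σ_{S ∈ tri} ang S v = Σ_{S ∋ v} ang S v ≤ 3·arccos(1/4) + 2·arccos(807/2000) < 2π`
(numerically `3.9543 + 2.3110 = 6.2653 < 6.2832`).

The numerical inequality is proved exactly: with `a = arccos (1/4)` and `b = arccos (807/2000)`,
`cos (3a) = 4cos³a − 3cos a = −11/16` and `cos (2b) = 2cos²b − 1 = −1348751/2000000`; both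
`2π − 3a` and `2b` lie in `[0, π]`, where `cos` is strictly decreasing, and
`−11/16 < −1348751/2000000`, whence `2b < 2π − 3a`.
-/

noncomputable section

namespace Summit.AtomisticToContinuum.Crystallization.Theorems

open Real

/-- `π/3 < arccos (1/4) < π/2`. -/
private theorem kill3T2H_arccos_quarter_bounds :
    π / 3 < arccos (1 / 4) ∧ arccos (1 / 4) < π / 2 := by
  constructor
  · rw [← arccos_cos (x := π / 3) (by positivity) (by linarith [pi_pos]), cos_pi_div_three]
    exact arccos_lt_arccos (by norm_num) (by norm_num) (by norm_num)
  · rw [← arccos_zero]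
    exact arccos_lt_arccos (by norm_num) (by norm_num) (by norm_num)

/-- `π/3 < arccos (807/2000) < π/2`. -/
private theorem kill3T2H_arccos_807_bounds :
    π / 3 < arccos (807 / 2000) ∧ arccos (807 / 2000) < π / 2 := by
  constructor
  · rw [← arccos_cos (x := π / 3) (by positivity) (by linarith [pi_pos]), cos_pi_div_three]
    exact arccos_lt_arccos (by norm_num) (by norm_num) (by norm_num)
  · rw [← arccos_zero]
    exact arccos_lt_arccos (by norm_num) (by norm_num) (by norm_num)

/-- `cos (3 · arccos (1/4)) = −11/16`. -/
private theorem kill3T2H_cos_three_arccos_quarter : cos (3 * arccos (1 / 4)) = -11 / 16 := by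
  rw [cos_three_mul, cos_arccos (by norm_num) (by norm_num)]
  norm_num

/-- `cos (2 · arccos (807/2000)) = −1348751/2000000`. -/
private theorem kill3T2H_cos_two_arccos_807 :
    cos (2 * arccos (807 / 2000)) = -1348751 / 2000000 := by
  rw [cos_two_mul, cos_arccos (by norm_num) (by norm_num)]
  norm_num

/-- **The `3T+2H` angle budget fails:** `3·arccos(1/4) + 2·arccos(807/2000) < 2π`
(numerically `3.9543 + 2.3110 = 6.2653 < 6.2832`). -/
private theorem kill3T2H_budget :
    3 * arccos (1 / 4) + 2 * arccos (807 / 2000) < 2 * π := by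
  obtain ⟨ha1, ha2⟩ := kill3T2H_arccos_quarter_bounds
  obtain ⟨hb1, hb2⟩ := kill3T2H_arccos_807_bounds
  set a := arccos (1 / 4) with ha
  set b := arccos (807 / 2000) with hb
  -- `2π − 3a` and `2b` both lie in `[0, π]`
  have hx0 : 0 ≤ 2 * π - 3 * a := by linarith
  have hxπ : 2 * π - 3 * a ≤ π := by linarith
  have hy0 : 0 ≤ 2 * b := by linarith [pi_pos]
  have hyπ : 2 * b ≤ π := by linarith
  -- `cos (2π − 3a) = cos (3a) = −11/16 < cos (2b)`
  have hcx : cos (2 * π - 3 * a) = -11 / 16 := by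
    rw [cos_sub, cos_two_pi, sin_two_pi, kill3T2H_cos_three_arccos_quarter]; ring
  have hcy : cos (2 * b) = -1348751 / 2000000 := kill3T2H_cos_two_arccos_807
  have hlt : cos (2 * π - 3 * a) < cos (2 * b) := by rw [hcx, hcy]; norm_num
  -- `cos` is strictly decreasing on `[0, π]`, hence `2b < 2π − 3a`
  have key : 2 * b < 2 * π - 3 * a := by
    by_contra h
    push Not at h
    have := Real.strictAntiOn_cos.antitoneOn (Set.mem_Icc.2 ⟨hx0, hxπ⟩)
      (Set.mem_Icc.2 ⟨hy0, hyπ⟩) h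
    linarith
  linarith

/-- Summing a nonnegative function over `insert p s` gives at most `f p` plus the sum over `s`;
no freshness of `p` is needed. -/
private theorem kill3T2H_sum_insert_le {ι : Type*} [DecidableEq ι] (f : ι → ℝ)
    (hf : ∀ i, 0 ≤ f i) (p : ι) (s : Finset ι) :
    ∑ i ∈ insert p s, f i ≤ f p + ∑ i ∈ s, f i := by
  by_cases hp : p ∈ s
  · rw [Finset.insert_eq_of_mem hp]
    linarith [hf p]
  · rw [Finset.sum_insert hp]

/-- A triangle `{p, q, r}` whose three sides `p q`, `p r`, `q r` are bonds is a bond clique: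
any two distinct labels of it are bonded. -/
private theorem kill3T2H_clique (bond : Fin 12 → Fin 12 → Bool)
    (bond_symm : ∀ v w, bond v w = bond w v) (p q r : Fin 12) (hpq : bond p q = true)
    (hpr : bond p r = true) (hqr : bond q r = true) :
    ∀ y ∈ ({p, q, r} : Finset (Fin 12)), ∀ z ∈ ({p, q, r} : Finset (Fin 12)),
      y ≠ z → bond y z = true := by
  intro y hy z hz hyz
  simp only [Finset.mem_insert, Finset.mem_singleton] at hy hz
  rcases hy with rfl | rfl | rfl <;> rcases hz with rfl | rfl | rfl
  all_goals first | exact absurd rfl hyz | assumption | (rw [bond_symm]; assumption)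

/-- **`3T+2H` is dead.**  In the abstract census data (`bond`, `tri`, `ang`) of a shell, no
label `v` has as its star the three bond triangles `{v,a,b}`, `{v,b,c}`, `{v,c,d}` together with
the two halves `{v,d,x}`, `{v,a,x}` of the quad `v d x a` cut by the non-bond diagonal `v x`:
the five corners at `v` total at most `3·arccos(1/4) + 2·arccos(807/2000) < 2π`, contradicting
the full angle `Σ_{S ∈ tri} ang S v = 2π`. -/
theorem stub_kill3T2H (bond : Fin 12 → Fin 12 → Bool) (tri : Finset (Finset (Fin 12)))
    (ang : Finset (Fin 12) → Fin 12 → ℝ) (bond_symm : ∀ v w, bond v w = bond w v)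
    (ang_nonneg : ∀ S v, 0 ≤ ang S v) (ang_zero : ∀ S v, v ∉ S → ang S v = 0)
    (sum_ang : ∀ v, ∑ S ∈ tri, ang S v = 2 * Real.pi)
    (tCorner : ∀ S ∈ tri, (∀ v ∈ S, ∀ w ∈ S, v ≠ w → bond v w = true) → ∀ v ∈ S, ang S v ≤ Real.arccos (1 / 4))
    (hCorner : ∀ v a x, ({v, a, x} : Finset (Fin 12)) ∈ tri → bond v a = true → bond a x = true →
      bond v x = false → v ≠ x → ang {v, a, x} v ≤ Real.arccos (807 / 2000))
    (v a b c d x : Fin 12)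
    (hstar : (tri.filter fun S => v ∈ S) = {{v, a, b}, {v, b, c}, {v, c, d}, {v, d, x}, {v, a, x}})
    (hva : bond v a = true) (hvb : bond v b = true) (hvc : bond v c = true) (hvd : bond v d = true)
    (hab : bond a b = true) (hbc : bond b c = true) (hcd : bond c d = true) (hdx : bond d x = true)
    (hax : bond a x = true) (hvx : bond v x = false) (hvx' : v ≠ x) :
    False := by
  -- the five triangles of the star belong to `tri`
  have hmem : ∀ S ∈ ({{v, a, b}, {v, b, c}, {v, c, d}, {v, d, x}, {v, a, x}} :
      Finset (Finset (Fin 12))), S ∈ tri := by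
    intro S hS
    rw [← hstar] at hS
    exact (Finset.mem_filter.mp hS).1
  have mab : ({v, a, b} : Finset (Fin 12)) ∈ tri := hmem _ (by simp)
  have mbc : ({v, b, c} : Finset (Fin 12)) ∈ tri := hmem _ (by simp)
  have mcd : ({v, c, d} : Finset (Fin 12)) ∈ tri := hmem _ (by simp)
  have mdx : ({v, d, x} : Finset (Fin 12)) ∈ tri := hmem _ (by simp)
  have maxx : ({v, a, x} : Finset (Fin 12)) ∈ tri := hmem _ (by simp)
  -- the five corner bounds at `v`: three T-corners and two half-quad corners
  have e1 : ang {v, a, b} v ≤ arccos (1 / 4) :=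
    tCorner _ mab (kill3T2H_clique bond bond_symm v a b hva hvb hab) v
      (Finset.mem_insert_self _ _)
  have e2 : ang {v, b, c} v ≤ arccos (1 / 4) :=
    tCorner _ mbc (kill3T2H_clique bond bond_symm v b c hvb hvc hbc) v
      (Finset.mem_insert_self _ _)
  have e3 : ang {v, c, d} v ≤ arccos (1 / 4) :=
    tCorner _ mcd (kill3T2H_clique bond bond_symm v c d hvc hvd hcd) v
      (Finset.mem_insert_self _ _)
  have e4 : ang {v, d, x} v ≤ arccos (807 / 2000) := hCorner v d x mdx hvd hdx hvx hvx'
  have e5 : ang {v, a, x} v ≤ arccos (807 / 2000) := hCorner v a x maxx hva hax hvx hvx'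
  -- the full angle `2π` at `v` is carried by the star of `v`
  have hsum : ∑ S ∈ tri.filter (fun S => v ∈ S), ang S v = 2 * π := by
    rw [Finset.sum_filter_of_ne, sum_ang]
    intro S _ hne
    by_contra h
    exact hne (ang_zero S v h)
  rw [hstar] at hsum
  -- bound the sum over the five-element literal by the sum of the five values
  -- (no distinctness of the five triangles is needed, only `ang ≥ 0`)
  have key : ∀ (p : Finset (Fin 12)) (s : Finset (Finset (Fin 12))),
      ∑ S ∈ insert p s, ang S v ≤ ang p v + ∑ S ∈ s, ang S v := fun p s =>
    kill3T2H_sum_insert_le (fun S => ang S v) (fun S => ang_nonneg S v) p s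
  have h1 := key {v, a, b} {{v, b, c}, {v, c, d}, {v, d, x}, {v, a, x}}
  have h2 := key {v, b, c} {{v, c, d}, {v, d, x}, {v, a, x}}
  have h3 := key {v, c, d} {{v, d, x}, {v, a, x}}
  have h4 := key {v, d, x} {{v, a, x}}
  have h5 : ∑ S ∈ ({{v, a, x}} : Finset (Finset (Fin 12))), ang S v = ang {v, a, x} v := by
    rw [Finset.sum_singleton]
  have hnum := kill3T2H_budget
  linarith

end Summit.AtomisticToContinuum.Crystallization.Theorems

end
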